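import Summits.QuantumFields.YangMills.Theorems.UnitScaleTiltAvgActionDefectLoops
import Literature.MathematicalPhysics.QuantumFieldTheory.Balaban1983to89.BlockAveragingPlaquetteBound
import HarnessLib

/-!
# Route `UnitScaleTilt`, crux K1 child «MinimiserStabilityRegPr» (stmt-QuantumFields-19200), stub `stub_avgCurvGrad` (G-K1a-3a′) — helper:
# ONE-STEP AND `L`-STEP COVARIANT DIFFERENCES OF THE `L × L` SQUARE HOLONOMY ARE CONTROLLED BY THE PLAQUETTE COVARIANT DIFFERENCES

Cell `ym3-torus` (rung R3), seat `ym3-torus-p1` gen 8.  The located gap G-K1a-3a′ (`AvgCurvGradAt`: the curvature of the one-step (0.4) average has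
covariant gradients `≤ C₁b + C₂a²`) reduces, by helper 5 (`norm_plaqHol_avgFun_sub_mean_conj_rect_le`), to the statement of THIS file: the
covariant difference of the square holonomy `U(∂R_{L,L}(z))` across `L` fine steps is at most `L³·b + 4L⁴·a²` (`SU(N)` read in `M_N(ℂ)`; the
one-step covariant difference of `R` in direction `ν` at `z` is written `U(z,ν)⁻¹·R(z)·U(z,ν) − R(z + e_ν)` = the tree's `covDerivT 1` at `z + e_ν`).

* §1 algebra: `norm_conj_sub_conj_le`, `norm_conj_sub_self_le` (`‖kYk⁻¹ − Y‖ ≤ 2|k−1||Y−1|`), **`covDiff_mul_le`** (product rule),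
  **`covDiff_conj_le`** (conjugate rule: transporting along `h` costs the LADDER loop `h′⁻¹u⁻¹hv`), `covDiff_inv_le`, `covDiff_telescope_le`.
* §2 geometry: `shiftN_shift_comm`, `shiftN_comm'`, `rect_succ_right'`, `rect_succ_left'`, `rect_swap_inv` (`R_{μν}(s,1) = R_{νμ}(1,s)⁻¹`),
  `dist1_thinRect_le` (`|U(∂R_{s×1}) − 1| ≤ s·a`), `dist1_rect_le_mul` (`|U(∂R_{s×r}) − 1| ≤ s·r·a`), the two ladders as conjugated thin
  rectangles (`ladder_row_eq`, `ladder_col_eq`) or trivial (`ladder_self_eq_one`), `dist1_ladder_le`.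
* §3 **`covDiff_strip_le`**, **`covDiff_rect_le`**, **`covDiff_rect_steps_le`**: `‖U(z,ν)⁻¹U(∂R_{s,r}(z))U(z,ν) − U(∂R_{s,r}(z+e_ν))‖ ≤
  r·(s·(b + 2sa²) + 2·(ra)(sa))` and the `i`-step telescoped version; at `s = r = i = L`: `≤ L·(L²b + 4L³a²)`.
-/

noncomputable section

open scoped BigOperators Matrix.Norms.L2Operator

namespace Summit.QuantumFields.YangMills.Theorems.AvgCurvGrad

open Literature.MathematicalPhysics.QuantumFieldTheory.Balaban1983to89
open T4Continuum BlockAveraging AveragingRT B10Eq47AxialChi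
open Summit.QuantumFields.YangMills.Theorems.AvgActionDefect (shiftN_shift_self rowProd_succ_left)

/-! ## §1 Covariant differences in `M_N(ℂ)`: product rule, conjugate rule, inverses, telescoping -/

section Algebra

variable {n : Type*} [Fintype n] [DecidableEq n] [Nonempty n]

/-- In the model, `dist1 g = ‖g − 1‖` (operator norm). [folklore] -/
private theorem dist1_eq (g : Matrix.specialUnitaryGroup n ℂ) : dist1 g = ‖(g : Matrix n n ℂ) - 1‖ := rfl

/-- A special unitary matrix has operator norm `≤ 1`. [folklore] -/
private theorem norm_le_one (g : Matrix.specialUnitaryGroup n ℂ) : ‖(g : Matrix n n ℂ)‖ ≤ 1 :=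
  (UnitaryModel.norm_of_mem_unitaryGroup (Matrix.specialUnitaryGroup_le_unitaryGroup g.2)).le

omit [Nonempty n] in
/-- `↑(g * h) = ↑g * ↑h` for special unitary matrices. [folklore] -/
private theorem coe_mul' (g h : Matrix.specialUnitaryGroup n ℂ) :
    ((g * h : Matrix.specialUnitaryGroup n ℂ) : Matrix n n ℂ) = (g : Matrix n n ℂ) * (h : Matrix n n ℂ) := rfl

omit [Nonempty n] in
/-- `↑g * ↑g⁻¹ = 1`. [folklore] -/
private theorem coe_mul_inv (g : Matrix.specialUnitaryGroup n ℂ) :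
    (g : Matrix n n ℂ) * ((g⁻¹ : Matrix.specialUnitaryGroup n ℂ) : Matrix n n ℂ) = 1 := by
  rw [← coe_mul', mul_inv_cancel]; rfl

omit [Nonempty n] in
/-- `↑g⁻¹ * ↑g = 1`. [folklore] -/
private theorem coe_inv_mul (g : Matrix.specialUnitaryGroup n ℂ) :
    ((g⁻¹ : Matrix.specialUnitaryGroup n ℂ) : Matrix n n ℂ) * (g : Matrix n n ℂ) = 1 := by
  rw [← coe_mul', inv_mul_cancel]; rfl

/-- Conjugating a difference by a unitary does not increase its norm: `‖kXk⁻¹ − kYk⁻¹‖ ≤ ‖X − Y‖`. [folklore] -/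
theorem norm_conj_sub_conj_le (k : Matrix.specialUnitaryGroup n ℂ) (X Y : Matrix n n ℂ) :
    ‖(k : Matrix n n ℂ) * X * ((k⁻¹ : Matrix.specialUnitaryGroup n ℂ) : Matrix n n ℂ) -
        (k : Matrix n n ℂ) * Y * ((k⁻¹ : Matrix.specialUnitaryGroup n ℂ) : Matrix n n ℂ)‖ ≤ ‖X - Y‖ := by
  rw [show (k : Matrix n n ℂ) * X * ((k⁻¹ : Matrix.specialUnitaryGroup n ℂ) : Matrix n n ℂ) -
      (k : Matrix n n ℂ) * Y * ((k⁻¹ : Matrix.specialUnitaryGroup n ℂ) : Matrix n n ℂ) =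
      (k : Matrix n n ℂ) * (X - Y) * ((k⁻¹ : Matrix.specialUnitaryGroup n ℂ) : Matrix n n ℂ) by noncomm_ring]
  calc _ ≤ ‖(k : Matrix n n ℂ)‖ * ‖X - Y‖ * ‖((k⁻¹ : Matrix.specialUnitaryGroup n ℂ) : Matrix n n ℂ)‖ :=
        (norm_mul_le _ _).trans (mul_le_mul_of_nonneg_right (norm_mul_le _ _) (norm_nonneg _))
    _ ≤ 1 * ‖X - Y‖ * 1 := by gcongr <;> exact norm_le_one _
    _ = ‖X - Y‖ := by ring

/-- The same with the inverse on the left: `‖k⁻¹Xk − k⁻¹Yk‖ ≤ ‖X − Y‖`. [folklore] -/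
theorem norm_inv_conj_sub_le (k : Matrix.specialUnitaryGroup n ℂ) (X Y : Matrix n n ℂ) :
    ‖((k⁻¹ : Matrix.specialUnitaryGroup n ℂ) : Matrix n n ℂ) * X * (k : Matrix n n ℂ) -
        ((k⁻¹ : Matrix.specialUnitaryGroup n ℂ) : Matrix n n ℂ) * Y * (k : Matrix n n ℂ)‖ ≤ ‖X - Y‖ := by
  rw [show ((k⁻¹ : Matrix.specialUnitaryGroup n ℂ) : Matrix n n ℂ) * X * (k : Matrix n n ℂ) -
      ((k⁻¹ : Matrix.specialUnitaryGroup n ℂ) : Matrix n n ℂ) * Y * (k : Matrix n n ℂ) =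
      ((k⁻¹ : Matrix.specialUnitaryGroup n ℂ) : Matrix n n ℂ) * (X - Y) * (k : Matrix n n ℂ) by noncomm_ring]
  calc _ ≤ ‖((k⁻¹ : Matrix.specialUnitaryGroup n ℂ) : Matrix n n ℂ)‖ * ‖X - Y‖ * ‖(k : Matrix n n ℂ)‖ :=
        (norm_mul_le _ _).trans (mul_le_mul_of_nonneg_right (norm_mul_le _ _) (norm_nonneg _))
    _ ≤ 1 * ‖X - Y‖ * 1 := by gcongr <;> exact norm_le_one _
    _ = ‖X - Y‖ := by ring

/-- **`‖kYk⁻¹ − Y‖ ≤ 2·|k − 1|·|Y − 1|`** (`kYk⁻¹ − Y = (kY − Yk)k⁻¹`, `kY − Yk = (k−1)(Y−1) − (Y−1)(k−1)`). [folklore] -/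
theorem norm_conj_sub_self_le (k Y : Matrix.specialUnitaryGroup n ℂ) :
    ‖((k * Y * k⁻¹ : Matrix.specialUnitaryGroup n ℂ) : Matrix n n ℂ) - (Y : Matrix n n ℂ)‖ ≤ 2 * dist1 k * dist1 Y := by
  rw [dist1_eq, dist1_eq]
  have h : ((k * Y * k⁻¹ : Matrix.specialUnitaryGroup n ℂ) : Matrix n n ℂ) - (Y : Matrix n n ℂ) =
      (((k : Matrix n n ℂ) - 1) * ((Y : Matrix n n ℂ) - 1) - ((Y : Matrix n n ℂ) - 1) * ((k : Matrix n n ℂ) - 1)) *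
        ((k⁻¹ : Matrix.specialUnitaryGroup n ℂ) : Matrix n n ℂ) := by
    rw [coe_mul', coe_mul']
    have := coe_mul_inv k
    calc (k : Matrix n n ℂ) * (Y : Matrix n n ℂ) * ((k⁻¹ : Matrix.specialUnitaryGroup n ℂ) : Matrix n n ℂ) - (Y : Matrix n n ℂ)
        = (k : Matrix n n ℂ) * (Y : Matrix n n ℂ) * ((k⁻¹ : Matrix.specialUnitaryGroup n ℂ) : Matrix n n ℂ) -
            (Y : Matrix n n ℂ) * ((k : Matrix n n ℂ) * ((k⁻¹ : Matrix.specialUnitaryGroup n ℂ) : Matrix n n ℂ)) := by rw [this, mul_one]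
      _ = _ := by noncomm_ring
  rw [h]
  calc _ ≤ ‖((k : Matrix n n ℂ) - 1) * ((Y : Matrix n n ℂ) - 1) - ((Y : Matrix n n ℂ) - 1) * ((k : Matrix n n ℂ) - 1)‖ *
          ‖((k⁻¹ : Matrix.specialUnitaryGroup n ℂ) : Matrix n n ℂ)‖ := norm_mul_le _ _
    _ ≤ (‖(k : Matrix n n ℂ) - 1‖ * ‖(Y : Matrix n n ℂ) - 1‖ + ‖(Y : Matrix n n ℂ) - 1‖ * ‖(k : Matrix n n ℂ) - 1‖) * 1 := by
        gcongr
        · exact (norm_sub_le _ _).trans (add_le_add (norm_mul_le _ _) (norm_mul_le _ _))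
        · exact norm_le_one _
    _ = 2 * ‖(k : Matrix n n ℂ) - 1‖ * ‖(Y : Matrix n n ℂ) - 1‖ := by ring

/-- **PRODUCT RULE** for the one-step covariant difference `u⁻¹Xu − Y`: `‖u⁻¹(X₁X₂)u − Y₁Y₂‖ ≤ ‖u⁻¹X₁u − Y₁‖ + ‖u⁻¹X₂u − Y₂‖`. [folklore] -/
theorem covDiff_mul_le (u X₁ X₂ Y₁ Y₂ : Matrix.specialUnitaryGroup n ℂ) :
    ‖((u⁻¹ * (X₁ * X₂) * u : Matrix.specialUnitaryGroup n ℂ) : Matrix n n ℂ) - ((Y₁ * Y₂ : Matrix.specialUnitaryGroup n ℂ) : Matrix n n ℂ)‖ ≤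
      ‖((u⁻¹ * X₁ * u : Matrix.specialUnitaryGroup n ℂ) : Matrix n n ℂ) - (Y₁ : Matrix n n ℂ)‖ +
        ‖((u⁻¹ * X₂ * u : Matrix.specialUnitaryGroup n ℂ) : Matrix n n ℂ) - (Y₂ : Matrix n n ℂ)‖ := by
  have hg : u⁻¹ * (X₁ * X₂) * u = (u⁻¹ * X₁ * u) * (u⁻¹ * X₂ * u) := by group
  rw [hg, coe_mul' (u⁻¹ * X₁ * u) (u⁻¹ * X₂ * u), coe_mul' Y₁ Y₂]
  set A : Matrix n n ℂ := ((u⁻¹ * X₁ * u : Matrix.specialUnitaryGroup n ℂ) : Matrix n n ℂ)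
  set B : Matrix n n ℂ := ((u⁻¹ * X₂ * u : Matrix.specialUnitaryGroup n ℂ) : Matrix n n ℂ)
  have h : A * B - (Y₁ : Matrix n n ℂ) * (Y₂ : Matrix n n ℂ) = (A - Y₁) * B + (Y₁ : Matrix n n ℂ) * (B - Y₂) := by noncomm_ring
  rw [h]
  calc _ ≤ ‖A - Y₁‖ * ‖B‖ + ‖(Y₁ : Matrix n n ℂ)‖ * ‖B - Y₂‖ :=
        (norm_add_le _ _).trans (add_le_add (norm_mul_le _ _) (norm_mul_le _ _))
    _ ≤ ‖A - Y₁‖ * 1 + 1 * ‖B - Y₂‖ := by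
        gcongr
        · exact norm_le_one _
        · exact norm_le_one _
    _ = _ := by ring

/-- **CONJUGATE RULE**: transporting `X` along `h` and `Y` along `h′` before differencing costs the LADDER LOOP `h′⁻¹u⁻¹hv`:
`‖u⁻¹(hXh⁻¹)u − h′Yh′⁻¹‖ ≤ ‖v⁻¹Xv − Y‖ + 2·|h′⁻¹u⁻¹hv − 1|·|Y − 1|`. [folklore] -/
theorem covDiff_conj_le (u v h h' X Y : Matrix.specialUnitaryGroup n ℂ) :
    ‖((u⁻¹ * (h * X * h⁻¹) * u : Matrix.specialUnitaryGroup n ℂ) : Matrix n n ℂ) -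
        ((h' * Y * h'⁻¹ : Matrix.specialUnitaryGroup n ℂ) : Matrix n n ℂ)‖ ≤
      ‖((v⁻¹ * X * v : Matrix.specialUnitaryGroup n ℂ) : Matrix n n ℂ) - (Y : Matrix n n ℂ)‖ +
        2 * dist1 (h'⁻¹ * u⁻¹ * h * v) * dist1 Y := by
  set k : Matrix.specialUnitaryGroup n ℂ := h'⁻¹ * u⁻¹ * h * v with hk
  set Z : Matrix.specialUnitaryGroup n ℂ := v⁻¹ * X * v with hZ
  have hg : u⁻¹ * (h * X * h⁻¹) * u = h' * (k * Z * k⁻¹) * h'⁻¹ := by simp only [hk, hZ]; group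
  rw [hg, coe_mul' (h' * (k * Z * k⁻¹)) h'⁻¹, coe_mul' h' (k * Z * k⁻¹), coe_mul' (h' * Y) h'⁻¹, coe_mul' h' Y]
  refine (norm_conj_sub_conj_le h' _ _).trans ?_
  calc ‖((k * Z * k⁻¹ : Matrix.specialUnitaryGroup n ℂ) : Matrix n n ℂ) - (Y : Matrix n n ℂ)‖
      ≤ ‖((k * Z * k⁻¹ : Matrix.specialUnitaryGroup n ℂ) : Matrix n n ℂ) - ((k * Y * k⁻¹ : Matrix.specialUnitaryGroup n ℂ) : Matrix n n ℂ)‖ +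
          ‖((k * Y * k⁻¹ : Matrix.specialUnitaryGroup n ℂ) : Matrix n n ℂ) - (Y : Matrix n n ℂ)‖ := norm_sub_le_norm_sub_add_norm_sub _ _ _
    _ ≤ ‖(Z : Matrix n n ℂ) - (Y : Matrix n n ℂ)‖ + 2 * dist1 k * dist1 Y := by
        refine add_le_add ?_ (norm_conj_sub_self_le k Y)
        rw [coe_mul' (k * Z) k⁻¹, coe_mul' k Z, coe_mul' (k * Y) k⁻¹, coe_mul' k Y]
        exact norm_conj_sub_conj_le k _ _

/-- Inverses: `‖u⁻¹X⁻¹u − Y⁻¹‖ ≤ ‖u⁻¹Xu − Y‖` (`A⁻¹ − B⁻¹ = A⁻¹(B − A)B⁻¹` for unitaries). [folklore] -/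
theorem covDiff_inv_le (u X Y : Matrix.specialUnitaryGroup n ℂ) :
    ‖((u⁻¹ * X⁻¹ * u : Matrix.specialUnitaryGroup n ℂ) : Matrix n n ℂ) - ((Y⁻¹ : Matrix.specialUnitaryGroup n ℂ) : Matrix n n ℂ)‖ ≤
      ‖((u⁻¹ * X * u : Matrix.specialUnitaryGroup n ℂ) : Matrix n n ℂ) - (Y : Matrix n n ℂ)‖ := by
  set A : Matrix.specialUnitaryGroup n ℂ := u⁻¹ * X * u with hA
  have hinv : u⁻¹ * X⁻¹ * u = A⁻¹ := by simp only [hA]; group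
  rw [hinv]
  have h : ((A⁻¹ : Matrix.specialUnitaryGroup n ℂ) : Matrix n n ℂ) - ((Y⁻¹ : Matrix.specialUnitaryGroup n ℂ) : Matrix n n ℂ) =
      ((A⁻¹ : Matrix.specialUnitaryGroup n ℂ) : Matrix n n ℂ) * ((Y : Matrix n n ℂ) - (A : Matrix n n ℂ)) *
        ((Y⁻¹ : Matrix.specialUnitaryGroup n ℂ) : Matrix n n ℂ) := by
    rw [mul_sub, sub_mul, mul_assoc, coe_mul_inv, mul_one, coe_inv_mul, one_mul]
  rw [h]
  calc _ ≤ ‖((A⁻¹ : Matrix.specialUnitaryGroup n ℂ) : Matrix n n ℂ)‖ * ‖(Y : Matrix n n ℂ) - (A : Matrix n n ℂ)‖ *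
          ‖((Y⁻¹ : Matrix.specialUnitaryGroup n ℂ) : Matrix n n ℂ)‖ :=
        (norm_mul_le _ _).trans (mul_le_mul_of_nonneg_right (norm_mul_le _ _) (norm_nonneg _))
    _ ≤ 1 * ‖(Y : Matrix n n ℂ) - (A : Matrix n n ℂ)‖ * 1 := by gcongr <;> exact norm_le_one _
    _ = ‖(A : Matrix n n ℂ) - (Y : Matrix n n ℂ)‖ := by rw [one_mul, mul_one, norm_sub_rev]

/-- **TELESCOPING OVER `i` STEPS**: for a `G`-valued site function `R` and the straight transporter `rowProd U z ν i`,
`‖N_i⁻¹R(z)N_i − R(z + ie_ν)‖ ≤ Σ_{l<i} ‖U(z_l,ν)⁻¹R(z_l)U(z_l,ν) − R(z_{l+1})‖`, `z_l = z + le_ν`. [folklore] -/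
theorem covDiff_telescope_le {P : Params} {j : ℕ} (U : GaugeField P j (Matrix.specialUnitaryGroup n ℂ))
    (R : Site P j → Matrix.specialUnitaryGroup n ℂ) (z : Site P j) (ν : Fin P.d) :
    ∀ i : ℕ, ‖(((rowProd U z ν i)⁻¹ * R z * rowProd U z ν i : Matrix.specialUnitaryGroup n ℂ) : Matrix n n ℂ) -
        (R (shiftN z ν i) : Matrix n n ℂ)‖ ≤
      ∑ l ∈ Finset.range i, ‖(((U ⟨shiftN z ν l, ν⟩)⁻¹ * R (shiftN z ν l) * U ⟨shiftN z ν l, ν⟩ : Matrix.specialUnitaryGroup n ℂ) :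
          Matrix n n ℂ) - (R (shiftN z ν (l + 1)) : Matrix n n ℂ)‖
  | 0 => by simp [rowProd]
  | i + 1 => by
    rw [Finset.sum_range_succ]
    have hg : (rowProd U z ν (i + 1))⁻¹ * R z * rowProd U z ν (i + 1) =
        (U ⟨shiftN z ν i, ν⟩)⁻¹ * ((rowProd U z ν i)⁻¹ * R z * rowProd U z ν i) * U ⟨shiftN z ν i, ν⟩ := by
      rw [rowProd_succ]; group
    rw [hg]
    calc _ ≤ ‖(((U ⟨shiftN z ν i, ν⟩)⁻¹ * ((rowProd U z ν i)⁻¹ * R z * rowProd U z ν i) * U ⟨shiftN z ν i, ν⟩ :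
              Matrix.specialUnitaryGroup n ℂ) : Matrix n n ℂ) -
            (((U ⟨shiftN z ν i, ν⟩)⁻¹ * R (shiftN z ν i) * U ⟨shiftN z ν i, ν⟩ : Matrix.specialUnitaryGroup n ℂ) : Matrix n n ℂ)‖ +
          ‖(((U ⟨shiftN z ν i, ν⟩)⁻¹ * R (shiftN z ν i) * U ⟨shiftN z ν i, ν⟩ : Matrix.specialUnitaryGroup n ℂ) : Matrix n n ℂ) -
            (R (shiftN z ν (i + 1)) : Matrix n n ℂ)‖ := norm_sub_le_norm_sub_add_norm_sub _ _ _
      _ ≤ _ := add_le_add ?_ le_rfl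
    rw [coe_mul' ((U ⟨shiftN z ν i, ν⟩)⁻¹ * ((rowProd U z ν i)⁻¹ * R z * rowProd U z ν i)) (U ⟨shiftN z ν i, ν⟩),
      coe_mul' (U ⟨shiftN z ν i, ν⟩)⁻¹ ((rowProd U z ν i)⁻¹ * R z * rowProd U z ν i),
      coe_mul' ((U ⟨shiftN z ν i, ν⟩)⁻¹ * R (shiftN z ν i)) (U ⟨shiftN z ν i, ν⟩), coe_mul' (U ⟨shiftN z ν i, ν⟩)⁻¹ (R (shiftN z ν i))]
    exact (norm_inv_conj_sub_le _ _ _).trans (covDiff_telescope_le U R z ν i)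

end Algebra

/-! ## §2 Geometry: rectangle recursions, thin rectangles, ladders -/

section Geometry

variable {P : Params} {j : ℕ} {G : Type*} [GaugeGroup G]

/-- `shiftN (x + e_ν) μ n = (shiftN x μ n) + e_ν`. [folklore] -/
theorem shiftN_shift_comm (x : Site P j) (μ ν : Fin P.d) : ∀ n : ℕ, shiftN (x.shift ν) μ n = (shiftN x μ n).shift ν
  | 0 => rfl
  | n + 1 => by rw [shiftN_succ, shiftN_succ, shiftN_shift_comm x μ ν n, Site.shift_comm]

/-- Iterated shifts in two directions commute. [folklore] -/
theorem shiftN_comm' (x : Site P j) (μ ν : Fin P.d) (a : ℕ) : ∀ b : ℕ, shiftN (shiftN x ν b) μ a = shiftN (shiftN x μ a) ν b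
  | 0 => rfl
  | b + 1 => by rw [shiftN_succ, shiftN_succ, shiftN_shift_comm, shiftN_comm' x μ ν a b]

/-- `rowProd U x μ 1 = U(x, μ)`. [folklore] -/
theorem rowProd_one (U : GaugeField P j G) (x : Site P j) (μ : Fin P.d) : rowProd U x μ 1 = U ⟨x, μ⟩ := by
  simp [rowProd]

/-- Stacking one more row: `U(∂R_{a,b+1}) = U(∂R_{a,b}) · [h U(∂R′_{a,1}) h⁻¹]`, `h = rowProd U x κ b`, `R′` the strip at height `b`
(public twin of the tree's private `B10Eq47AxialChi.rect_succ_right`). [folklore] -/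
theorem rect_succ_right' (U : GaugeField P j G) (x : Site P j) (μ κ : Fin P.d) (a b : ℕ) :
    rect U x μ κ a (b + 1) = rect U x μ κ a b * (rowProd U x κ b * rect U (shiftN x κ b) μ κ a 1 * (rowProd U x κ b)⁻¹) := by
  simp only [rect, rowProd_succ, rowProd_zero, one_mul, shiftN_comm' x μ κ a b, shiftN_succ, shiftN_zero]
  group

/-- Stacking one more plaquette onto a strip: `U(∂R_{a+1,1}) = [g U(∂R_{1,1}(x + ae_μ)) g⁻¹] · U(∂R_{a,1})`, `g = rowProd U x μ a`. [folklore] -/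
theorem rect_succ_left' (U : GaugeField P j G) (x : Site P j) (μ κ : Fin P.d) (a : ℕ) :
    rect U x μ κ (a + 1) 1 = (rowProd U x μ a * rect U (shiftN x μ a) μ κ 1 1 * (rowProd U x μ a)⁻¹) * rect U x μ κ a 1 := by
  simp only [rect, rowProd_succ, rowProd_zero, one_mul, shiftN_succ, shiftN_zero, shiftN_shift_comm x μ κ a]
  group

/-- The `1 × 1` rectangle is the plaquette variable. [folklore] -/
theorem rect_one_one' (U : GaugeField P j G) (x : Site P j) {μ κ : Fin P.d} (h : μ < κ) :
    rect U x μ κ 1 1 = GaugeField.plaqHol U ⟨x, μ, κ, h⟩ := rect_one_one U x h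

/-- Swapping the sides of a thin rectangle inverts its holonomy: `U(∂R_{μν}(s,1)) = U(∂R_{νμ}(1,s))⁻¹`. [folklore] -/
theorem rect_swap_inv (U : GaugeField P j G) (x : Site P j) (μ ν : Fin P.d) (s : ℕ) :
    rect U x μ ν s 1 = (rect U x ν μ 1 s)⁻¹ := by
  simp only [rect, rowProd_one, shiftN_succ, shiftN_zero]
  group

/-- **A thin rectangle of length `s` is within `s·a` of `1`** on a field with plaquettes `< a` (`μ ≠ ν`, either order). [folklore] -/
theorem dist1_thinRect_le {a : ℝ} {U : GaugeField P j G} (hU : PlaqSmall a U) {μ ν : Fin P.d} (hμν : μ ≠ ν) (x : Site P j) (s : ℕ) :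
    dist1 (rect U x μ ν s 1) ≤ s * a := by
  rcases lt_or_gt_of_ne hμν with h | h
  · refine (dist1_rect_le U x h s 1).trans ?_
    calc ∑ t ∈ Finset.range 1, ∑ s' ∈ Finset.range s, dist1 (GaugeField.plaqHol U ⟨shiftN (shiftN x ν t) μ s', μ, ν, h⟩)
        ≤ ∑ _t ∈ Finset.range 1, ∑ _s' ∈ Finset.range s, a :=
          Finset.sum_le_sum fun _ _ => Finset.sum_le_sum fun _ _ => (hU _).le
      _ = s * a := by simp
  · rw [rect_swap_inv, GaugeGroup.dist1_inv]
    refine (dist1_rect_le U x h 1 s).trans ?_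
    calc ∑ t ∈ Finset.range s, ∑ s' ∈ Finset.range 1, dist1 (GaugeField.plaqHol U ⟨shiftN (shiftN x μ t) ν s', ν, μ, h⟩)
        ≤ ∑ _t ∈ Finset.range s, ∑ _s' ∈ Finset.range 1, a :=
          Finset.sum_le_sum fun _ _ => Finset.sum_le_sum fun _ _ => (hU _).le
      _ = s * a := by simp

/-- A rectangle `s × r` (`μ < κ`) is within `s·r·a` of `1` on a field with plaquettes `< a`. [folklore] -/
theorem dist1_rect_le_mul {a : ℝ} {U : GaugeField P j G} (hU : PlaqSmall a U) {μ κ : Fin P.d} (h : μ < κ) (x : Site P j) (s r : ℕ) :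
    dist1 (rect U x μ κ s r) ≤ s * r * a := by
  refine (dist1_rect_le U x h s r).trans ?_
  calc ∑ t ∈ Finset.range r, ∑ s' ∈ Finset.range s, dist1 (GaugeField.plaqHol U ⟨shiftN (shiftN x κ t) μ s', μ, κ, h⟩)
      ≤ ∑ _t ∈ Finset.range r, ∑ _s' ∈ Finset.range s, a :=
        Finset.sum_le_sum fun _ _ => Finset.sum_le_sum fun _ _ => (hU _).le
    _ = s * r * a := by simp; ring

/-- THE ROW LADDER IS A CONJUGATED THIN RECTANGLE: `(rowProd U (x+e_ν) μ s)⁻¹ U(x,ν)⁻¹ (rowProd U x μ s) U(x+se_μ,ν) = k·U(∂R_{μν}(s,1)(x))·k⁻¹`.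
[folklore] -/
theorem ladder_row_eq (U : GaugeField P j G) (x : Site P j) (μ ν : Fin P.d) (s : ℕ) :
    (rowProd U (x.shift ν) μ s)⁻¹ * (U ⟨x, ν⟩)⁻¹ * rowProd U x μ s * U ⟨shiftN x μ s, ν⟩ =
      ((rowProd U (x.shift ν) μ s)⁻¹ * (U ⟨x, ν⟩)⁻¹) * rect U x μ ν s 1 * ((rowProd U (x.shift ν) μ s)⁻¹ * (U ⟨x, ν⟩)⁻¹)⁻¹ := by
  simp only [rect, rowProd_one, shiftN_succ, shiftN_zero]
  group

/-- In its own direction the ladder is trivial: `(rowProd U (x+e_μ) μ s)⁻¹ U(x,μ)⁻¹ (rowProd U x μ s) U(x+se_μ,μ) = 1`. [folklore] -/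
theorem ladder_self_eq_one (U : GaugeField P j G) (x : Site P j) (μ : Fin P.d) (s : ℕ) :
    (rowProd U (x.shift μ) μ s)⁻¹ * (U ⟨x, μ⟩)⁻¹ * rowProd U x μ s * U ⟨shiftN x μ s, μ⟩ = 1 := by
  have h1 : rowProd U x μ s * U ⟨shiftN x μ s, μ⟩ = rowProd U x μ (s + 1) := (rowProd_succ U x μ s).symm
  have h2 : U ⟨x, μ⟩ * rowProd U (x.shift μ) μ s = rowProd U x μ (s + 1) := (rowProd_succ_left U x μ s).symm
  calc (rowProd U (x.shift μ) μ s)⁻¹ * (U ⟨x, μ⟩)⁻¹ * rowProd U x μ s * U ⟨shiftN x μ s, μ⟩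
      = (U ⟨x, μ⟩ * rowProd U (x.shift μ) μ s)⁻¹ * (rowProd U x μ s * U ⟨shiftN x μ s, μ⟩) := by group
    _ = 1 := by rw [h1, h2, inv_mul_cancel]

/-- **EVERY LADDER OF LENGTH `s` IS WITHIN `s·a` OF `1`** on a field with plaquettes `< a` (any directions). [folklore] -/
theorem dist1_ladder_le {a : ℝ} (ha : 0 ≤ a) {U : GaugeField P j G} (hU : PlaqSmall a U) (x : Site P j) (μ ν : Fin P.d) (s : ℕ) :
    dist1 ((rowProd U (x.shift ν) μ s)⁻¹ * (U ⟨x, ν⟩)⁻¹ * rowProd U x μ s * U ⟨shiftN x μ s, ν⟩) ≤ s * a := by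
  by_cases hμν : μ = ν
  · subst hμν
    rw [ladder_self_eq_one, GaugeGroup.dist1_one]
    positivity
  · rw [ladder_row_eq, GaugeGroup.dist1_conj]
    exact dist1_thinRect_le hU hμν x s

end Geometry

/-! ## §3 The covariant differences of strips and rectangles -/

section Rect

variable {n : Type*} [Fintype n] [DecidableEq n] [Nonempty n] {P : Params} {j : ℕ}

/-- **THE STRIP**: if every plaquette of `U` is within `a` of `1` (`a ≥ 0`) and every one-step covariant difference in direction `ν` of the
plaquette field of the plane `μ < κ` is `≤ b`, then the `s × 1` strip holonomy has one-step covariant difference `≤ s·(b + 2·(s·a)·a)` (product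
rule along the strip; each plaquette transported along the row, ladders `≤ s·a`). [folklore] -/
theorem covDiff_strip_le {a b : ℝ} (ha : 0 ≤ a) {U : GaugeField P j (Matrix.specialUnitaryGroup n ℂ)} (hU : PlaqSmall a U)
    {μ κ : Fin P.d} (hμκ : μ < κ) (ν : Fin P.d)
    (hb : ∀ z : Site P j, ‖(((U ⟨z, ν⟩)⁻¹ * GaugeField.plaqHol U ⟨z, μ, κ, hμκ⟩ * U ⟨z, ν⟩ : Matrix.specialUnitaryGroup n ℂ) :
        Matrix n n ℂ) - ((GaugeField.plaqHol U ⟨z.shift ν, μ, κ, hμκ⟩ : Matrix.specialUnitaryGroup n ℂ) : Matrix n n ℂ)‖ ≤ b)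
    (x : Site P j) : ∀ s : ℕ,
    ‖(((U ⟨x, ν⟩)⁻¹ * rect U x μ κ s 1 * U ⟨x, ν⟩ : Matrix.specialUnitaryGroup n ℂ) : Matrix n n ℂ) -
        ((rect U (x.shift ν) μ κ s 1 : Matrix.specialUnitaryGroup n ℂ) : Matrix n n ℂ)‖ ≤ s * (b + 2 * (s * a) * a)
  | 0 => by simp [rect, rowProd]
  | s + 1 => by
    have hb0 : 0 ≤ b := (norm_nonneg _).trans (hb x)
    rw [rect_succ_left' U x μ κ s, rect_succ_left' U (x.shift ν) μ κ s]
    refine (covDiff_mul_le _ _ _ _ _).trans ?_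
    have ih := covDiff_strip_le ha hU hμκ ν hb x s
    -- the new plaquette, transported along the row of length `s`
    have hnew := covDiff_conj_le (U ⟨x, ν⟩) (U ⟨shiftN x μ s, ν⟩) (rowProd U x μ s) (rowProd U (x.shift ν) μ s)
      (rect U (shiftN x μ s) μ κ 1 1) (rect U (shiftN (x.shift ν) μ s) μ κ 1 1)
    have hlad := dist1_ladder_le ha hU x μ ν s
    have hW : dist1 (rect U (shiftN (x.shift ν) μ s) μ κ 1 1) ≤ a := by
      rw [rect_one_one' U _ hμκ]; exact (hU _).le
    have hstep : ‖(((U ⟨shiftN x μ s, ν⟩)⁻¹ * rect U (shiftN x μ s) μ κ 1 1 * U ⟨shiftN x μ s, ν⟩ : Matrix.specialUnitaryGroup n ℂ) :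
        Matrix n n ℂ) - ((rect U (shiftN (x.shift ν) μ s) μ κ 1 1 : Matrix.specialUnitaryGroup n ℂ) : Matrix n n ℂ)‖ ≤ b := by
      rw [rect_one_one' U _ hμκ, rect_one_one' U _ hμκ, shiftN_shift_comm]
      exact hb _
    have hW0 : 0 ≤ dist1 (rect U (shiftN (x.shift ν) μ s) μ κ 1 1) := GaugeGroup.dist1_nonneg _
    have hs0 : (0 : ℝ) ≤ s := Nat.cast_nonneg s
    have h2 : 2 * dist1 ((rowProd U (x.shift ν) μ s)⁻¹ * (U ⟨x, ν⟩)⁻¹ * rowProd U x μ s * U ⟨shiftN x μ s, ν⟩) *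
        dist1 (rect U (shiftN (x.shift ν) μ s) μ κ 1 1) ≤ 2 * (s * a) * a :=
      mul_le_mul (mul_le_mul_of_nonneg_left hlad (by norm_num)) hW hW0 (by positivity)
    have hfirst := hnew.trans (add_le_add hstep h2)
    have hmono : b + 2 * (s * a) * a ≤ b + 2 * ((s + 1) * a) * a := by nlinarith [mul_nonneg ha ha]
    calc _ ≤ (b + 2 * (s * a) * a) + s * (b + 2 * (s * a) * a) := add_le_add hfirst ih
      _ = (s + 1) * (b + 2 * (s * a) * a) := by ring
      _ ≤ (s + 1) * (b + 2 * ((s + 1) * a) * a) := mul_le_mul_of_nonneg_left hmono (by positivity)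
      _ = ((s + 1 : ℕ) : ℝ) * (b + 2 * (((s + 1 : ℕ) : ℝ) * a) * a) := by push_cast; ring

/-- **THE RECTANGLE**: under the same hypotheses the `s × r` rectangle holonomy has one-step covariant difference
`≤ r·(s·(b + 2(sa)a) + 2·(ra)·(sa))` (product rule over the rows; each strip transported along the column of length `< r`, ladders `≤ ra`,
strips within `sa` of `1`). [folklore] -/
theorem covDiff_rect_le {a b : ℝ} (ha : 0 ≤ a) {U : GaugeField P j (Matrix.specialUnitaryGroup n ℂ)} (hU : PlaqSmall a U)
    {μ κ : Fin P.d} (hμκ : μ < κ) (ν : Fin P.d)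
    (hb : ∀ z : Site P j, ‖(((U ⟨z, ν⟩)⁻¹ * GaugeField.plaqHol U ⟨z, μ, κ, hμκ⟩ * U ⟨z, ν⟩ : Matrix.specialUnitaryGroup n ℂ) :
        Matrix n n ℂ) - ((GaugeField.plaqHol U ⟨z.shift ν, μ, κ, hμκ⟩ : Matrix.specialUnitaryGroup n ℂ) : Matrix n n ℂ)‖ ≤ b)
    (s : ℕ) (x : Site P j) : ∀ r : ℕ,
    ‖(((U ⟨x, ν⟩)⁻¹ * rect U x μ κ s r * U ⟨x, ν⟩ : Matrix.specialUnitaryGroup n ℂ) : Matrix n n ℂ) -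
        ((rect U (x.shift ν) μ κ s r : Matrix.specialUnitaryGroup n ℂ) : Matrix n n ℂ)‖ ≤ r * (s * (b + 2 * (s * a) * a) + 2 * (r * a) * (s * a))
  | 0 => by simp [rect, rowProd]
  | r + 1 => by
    have hb0 : 0 ≤ b := (norm_nonneg _).trans (hb x)
    rw [rect_succ_right' U x μ κ s r, rect_succ_right' U (x.shift ν) μ κ s r]
    refine (covDiff_mul_le _ _ _ _ _).trans ?_
    have ih := covDiff_rect_le ha hU hμκ ν hb s x r
    have hnew := covDiff_conj_le (U ⟨x, ν⟩) (U ⟨shiftN x κ r, ν⟩) (rowProd U x κ r) (rowProd U (x.shift ν) κ r)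
      (rect U (shiftN x κ r) μ κ s 1) (rect U (shiftN (x.shift ν) κ r) μ κ s 1)
    have hlad := dist1_ladder_le ha hU x κ ν r
    have hS : dist1 (rect U (shiftN (x.shift ν) κ r) μ κ s 1) ≤ s * a := by
      have := dist1_rect_le_mul hU hμκ (shiftN (x.shift ν) κ r) s 1
      simpa using this
    have hstrip : ‖(((U ⟨shiftN x κ r, ν⟩)⁻¹ * rect U (shiftN x κ r) μ κ s 1 * U ⟨shiftN x κ r, ν⟩ : Matrix.specialUnitaryGroup n ℂ) :
        Matrix n n ℂ) - ((rect U (shiftN (x.shift ν) κ r) μ κ s 1 : Matrix.specialUnitaryGroup n ℂ) : Matrix n n ℂ)‖ ≤ s * (b + 2 * (s * a) * a) := by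
      rw [shiftN_shift_comm]
      exact covDiff_strip_le ha hU hμκ ν hb _ s
    have hS0 : 0 ≤ dist1 (rect U (shiftN (x.shift ν) κ r) μ κ s 1) := GaugeGroup.dist1_nonneg _
    have hr0 : (0 : ℝ) ≤ r := Nat.cast_nonneg r
    have hs0 : (0 : ℝ) ≤ s := Nat.cast_nonneg s
    have h2 : 2 * dist1 ((rowProd U (x.shift ν) κ r)⁻¹ * (U ⟨x, ν⟩)⁻¹ * rowProd U x κ r * U ⟨shiftN x κ r, ν⟩) *
        dist1 (rect U (shiftN (x.shift ν) κ r) μ κ s 1) ≤ 2 * (r * a) * (s * a) :=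
      mul_le_mul (mul_le_mul_of_nonneg_left hlad (by norm_num)) hS hS0 (by positivity)
    have hsecond := hnew.trans (add_le_add hstrip h2)
    have hmono : s * (b + 2 * (s * a) * a) + 2 * (r * a) * (s * a) ≤ s * (b + 2 * (s * a) * a) + 2 * ((r + 1) * a) * (s * a) := by
      nlinarith [mul_nonneg ha (mul_nonneg hs0 ha)]
    have hX0 : 0 ≤ s * (b + 2 * (s * a) * a) + 2 * (r * a) * (s * a) := by positivity
    calc _ ≤ r * (s * (b + 2 * (s * a) * a) + 2 * (r * a) * (s * a)) + (s * (b + 2 * (s * a) * a) + 2 * (r * a) * (s * a)) :=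
          add_le_add ih hsecond
      _ = (r + 1) * (s * (b + 2 * (s * a) * a) + 2 * (r * a) * (s * a)) := by ring
      _ ≤ (r + 1) * (s * (b + 2 * (s * a) * a) + 2 * ((r + 1) * a) * (s * a)) := mul_le_mul_of_nonneg_left hmono (by positivity)
      _ = ((r + 1 : ℕ) : ℝ) * (s * (b + 2 * (s * a) * a) + 2 * (((r + 1 : ℕ) : ℝ) * a) * (s * a)) := by push_cast; ring

/-- **THE `i`-STEP COVARIANT DIFFERENCE OF THE RECTANGLE** (telescoping §1 + `covDiff_rect_le` at every intermediate site):
`‖N_i⁻¹U(∂R_{s,r}(z))N_i − U(∂R_{s,r}(z + ie_ν))‖ ≤ i·r·(s·(b + 2(sa)a) + 2(ra)(sa))`, `N_i = rowProd U z ν i`; at `s = r = i = L` this is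
`L³·b + 4L⁴·a²`. [folklore] -/
theorem covDiff_rect_steps_le {a b : ℝ} (ha : 0 ≤ a) {U : GaugeField P j (Matrix.specialUnitaryGroup n ℂ)} (hU : PlaqSmall a U)
    {μ κ : Fin P.d} (hμκ : μ < κ) (ν : Fin P.d)
    (hb : ∀ z : Site P j, ‖(((U ⟨z, ν⟩)⁻¹ * GaugeField.plaqHol U ⟨z, μ, κ, hμκ⟩ * U ⟨z, ν⟩ : Matrix.specialUnitaryGroup n ℂ) :
        Matrix n n ℂ) - ((GaugeField.plaqHol U ⟨z.shift ν, μ, κ, hμκ⟩ : Matrix.specialUnitaryGroup n ℂ) : Matrix n n ℂ)‖ ≤ b)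
    (s r : ℕ) (z : Site P j) (i : ℕ) :
    ‖(((rowProd U z ν i)⁻¹ * rect U z μ κ s r * rowProd U z ν i : Matrix.specialUnitaryGroup n ℂ) : Matrix n n ℂ) -
        ((rect U (shiftN z ν i) μ κ s r : Matrix.specialUnitaryGroup n ℂ) : Matrix n n ℂ)‖ ≤ i * (r * (s * (b + 2 * (s * a) * a) + 2 * (r * a) * (s * a))) := by
  refine (covDiff_telescope_le U (fun w => rect U w μ κ s r) z ν i).trans ?_
  calc ∑ l ∈ Finset.range i, ‖(((U ⟨shiftN z ν l, ν⟩)⁻¹ * rect U (shiftN z ν l) μ κ s r * U ⟨shiftN z ν l, ν⟩ :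
          Matrix.specialUnitaryGroup n ℂ) : Matrix n n ℂ) - ((rect U (shiftN z ν (l + 1)) μ κ s r : Matrix.specialUnitaryGroup n ℂ) : Matrix n n ℂ)‖
      ≤ ∑ _l ∈ Finset.range i, r * (s * (b + 2 * (s * a) * a) + 2 * (r * a) * (s * a)) :=
        Finset.sum_le_sum fun l _ => by rw [shiftN_succ]; exact covDiff_rect_le ha hU hμκ ν hb s _ r
    _ = _ := by simp

end Rect

end Summit.QuantumFields.YangMills.Theorems.AvgCurvGrad

end
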